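import Mathlib
import Summits.Ventures.PercRepro2.Defs
import Summits.Ventures.PercRepro2.Harris
import Summits.Ventures.PercRepro2.Graph
import Summits.Ventures.PercRepro2.Events
import Summits.Ventures.PercRepro2.TReduction
import Summits.Ventures.PercRepro2.TReductionBase
import Summits.Ventures.PercRepro2.THBaseEnum
import Summits.Ventures.PercRepro2.THClassVEnum
import Summits.Ventures.PercRepro2.THClassIVGraph
import Summits.Ventures.PercRepro2.THClassIVEnum

/-!
# Slice B of the base-case census of the class-(iv) graph: edge `r x₂` open (mine-a g50)

The pinning patterns with `s0 = 1` (the edge `r x₂` open, i.e. contracted), split by the state of `r x₃`.  Every lemma is a kernel evaluation (`decide +kernel`) of `THClassIV.enum` over all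
patterns of the remaining edges: the antipodal base case of the class-(iv) graph at the pair
`({x₃, x₄ ∈ T}, {x₆ ∈ T})` is nonnegative at every proper pinning in this slice.  Together
(`THClassIV.enum_nonneg`) the slices cover every pattern other than «every edge free».
No instance, no notation.
-/

namespace Summit.Ventures.PercRepro2

namespace THClassIV

set_option maxHeartbeats 0 in
/-- `r x₂` open, `r x₃` in state `0`: `4^8` leaves. -/
lemma slice_1_0 : ∀ s2 s3 s4 s5 s6 s7 s8 s9 : Fin 3, 0 ≤ enum 1 0 s2 s3 s4 s5 s6 s7 s8 s9 := by
  decide +kernel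

set_option maxHeartbeats 0 in
/-- `r x₂` open, `r x₃` in state `1`: `4^8` leaves. -/
lemma slice_1_1 : ∀ s2 s3 s4 s5 s6 s7 s8 s9 : Fin 3, 0 ≤ enum 1 1 s2 s3 s4 s5 s6 s7 s8 s9 := by
  decide +kernel

set_option maxHeartbeats 0 in
/-- `r x₂` open, `r x₃` in state `2`: `4^8` leaves. -/
lemma slice_1_2 : ∀ s2 s3 s4 s5 s6 s7 s8 s9 : Fin 3, 0 ≤ enum 1 2 s2 s3 s4 s5 s6 s7 s8 s9 := by
  decide +kernel


end THClassIV

end Summit.Ventures.PercRepro2
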